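import Mathlib
import Summits.ValiantsHypothesis.ValiantsHypothesis.Theses.LacunarySymmetroid
import Summits.ValiantsHypothesis.ValiantsHypothesis.Theorems.LacunarySymmetroidMatrixDescartesCensusDefs
import Summits.ValiantsHypothesis.ValiantsHypothesis.Theorems.LacunarySymmetroidMatrixDescartesStubArith4
import Summits.ValiantsHypothesis.ValiantsHypothesis.Theorems.LacunarySymmetroidMatrixDescartesStubNegRoots
import Summits.ValiantsHypothesis.ValiantsHypothesis.Theorems.LacunarySymmetroidPencilTransfer
import Summits.ValiantsHypothesis.ValiantsHypothesis.Theorems.LacunarySymmetroidTowerThetaWitness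

/-!
# Route LacunarySymmetroid — the TOWER DOOR: `TowerB → ValiantsHypothesis` (summit glue of record, landed in `Theorems/`)

P1 landing (director-valiant R300 (3); lead R2806/R2809; crit-6 V#35 PASS on the workfile) of `Cruxes/MatrixDescartes/TowerDoorComplete.lean`
@ca015990e815 (val-idea-22 g7).  This file is the DOOR itself, def-free: every hypothesis is stated INLINE —
* the TOWER condition on a support `d : Fin K → ℕ` relative to the size `m`: `∀ l l', l < l' → m·d l < d l'` (= `IsTower` of LINE (B)
  `Cruxes/WeakLifting/Lines/tower_graft.lean`);
* **`TowerB`** (head of LINE (B), Conjecture B on tower supports in the census currency `PosRootLawOn`):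
  `∃ C, ∀ m K d, tower → PosRootLawOn m K (2^(C (K + log₂² m))) d` — written out so that LINE (B)'s `TowerB` matches by `Iff.rfl`;
* `TowerRealRootLaw` (all-real-roots currency), `TowerMatrixDescartes` (the crux `MatrixDescartes` restricted to towers), `TowerThetaWitness`
  (the tower-weighted VNP witness; PROVED in …TowerThetaWitness as `towerThetaWitness_holds`) likewise inline.
Theorems (verbatim proofs from the workfile): `isTower_cons_pow`, `window_lt`, `towerMatrixDescartes_of_towerRealRootLaw` (the arithmetic of
`Census.matrixDescartes_of_kPlusLogSqLaw` with the tower hypothesis threaded), `towerMatrixDescartes_of_matrixDescartes`, **`closes_tower`**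
(tower-restricted crux + `PencilTransfer` + tower witness ⇒ `VP ≠ VNP`: the arithmetic of `LacunarySymmetroid.closes`, the transferred support
`(0, (2^n)^i)` being an `m`-tower in the quasi-polynomial window), `valiant_of_towerRealRootLaw`, `towerRealRootLaw_of_towerB` (reflection `X ↦ −X`,
tree `stub_negRoots`), **`valiant_of_towerB`**, and the joints with the two other legs DISCHARGED by the tree (`pencilTransfer_proof`, stmt-18051 CLOSED;
`towerThetaWitness_holds`): **`valiant_of_towerB_alone : TowerB → ValiantsHypothesis`**, `valiant_of_towerRealRootLaw_alone`.

HONEST FRAMING.  VP ≠ VNP is NOT proved: `TowerB` is OPEN (research floor of LINE (B) = the `stub_towerLaw` family; with the line's proved joints each of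
S5 `TowerGraftLaw` / S4f `TowerSizeDoublingPoly` is summit-deciding through this door).  No `closes` binder of any route is touched by this file
(director R300 (2)); `MatrixDescartes` (stmt-ValiantsHypothesis-18050) stays OPEN.  Helper rows `--supports stmt-ValiantsHypothesis-18050`.  Landing hand:
val-sym-eng-2 g7.  [folklore] elementary arithmetic on the tree's `closes`, `PencilTransfer`, `stub_negRoots`.
-/

set_option linter.dupNamespace false

open Polynomial
open scoped BigOperators

namespace Summit.ValiantsHypothesis.ValiantsHypothesis.Theorems.LacunarySymmetroid.TowerDoor

open Summit.ValiantsHypothesis.ValiantsHypothesis.Theses.LacunarySymmetroid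
  (MatrixDescartes PencilTransfer ThetaWitness)
open Summit.ValiantsHypothesis.ValiantsHypothesis.Theorems.LacunarySymmetroidMatrixDescartes

/-- Auxiliary step `isTower_cons_pow` of the tower-door witness (verbatim from the workfile). [folklore] -/
theorem isTower_cons_pow {m G n : ℕ} (hmG : m < G) :
    ∀ l l' : Fin (n + 1), l < l' →
      m * (Fin.cons (α := fun _ => ℕ) (0 : ℕ) (fun i : Fin n => G ^ (i : ℕ)) l)
        < Fin.cons (α := fun _ => ℕ) (0 : ℕ) (fun i : Fin n => G ^ (i : ℕ)) l' := by
  intro l l' hll'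
  have hG1 : 1 ≤ G := by omega
  induction l using Fin.cases with
  | zero =>
    induction l' using Fin.cases with
    | zero => exact absurd hll' (lt_irrefl _)
    | succ j => simp only [Fin.cons_zero, Fin.cons_succ, mul_zero]; exact Nat.one_le_pow _ _ hG1
  | succ i =>
    induction l' using Fin.cases with
    | zero => exact absurd hll' (Fin.not_lt_zero _)
    | succ j =>
      simp only [Fin.cons_succ]
      have hij : (i : ℕ) < j := by
        have := Fin.succ_lt_succ_iff.1 hll'
        exact this
      calc m * G ^ (i : ℕ) < G * G ^ (i : ℕ) := Nat.mul_lt_mul_of_pos_right hmG (Nat.one_le_pow _ _ hG1)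
        _ = G ^ ((i : ℕ) + 1) := (pow_succ' _ _).symm
        _ ≤ G ^ (j : ℕ) := Nat.pow_le_pow_right hG1 hij

/-- The quasi-polynomial window is eventually below `2^n`: `(⌊log₂ n⌋ + c)^c < n` for all large `n`. -/
theorem window_lt (c : ℕ) : ∃ n₁ : ℕ, ∀ n : ℕ, n₁ ≤ n → (Nat.log 2 n + c) ^ c < n := by
  obtain ⟨L₁, hL₁⟩ := StubArith4.poly_le_two_pow c 2
  refine ⟨2 ^ L₁, fun n hn => ?_⟩
  have hn0 : n ≠ 0 := by have := Nat.one_le_two_pow (n := L₁); omega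
  have hL : L₁ ≤ Nat.log 2 n := Nat.le_log_of_pow_le one_lt_two hn
  have h1 : 2 * (Nat.log 2 n + c) ^ c ≤ 2 ^ Nat.log 2 n := hL₁ _ hL
  have h2 : 2 ^ Nat.log 2 n ≤ n := Nat.pow_log_le_self 2 hn0
  omega

/-- **Bridge** `TowerRealRootLaw → TowerMatrixDescartes` (the arithmetic of
`Census.matrixDescartes_of_kPlusLogSqLaw`, with the tower hypothesis threaded through). -/
theorem towerMatrixDescartes_of_towerRealRootLaw (h : (∃ C : ℕ, ∀ (m K : ℕ) (d : Fin K → ℕ) (S : Fin K → Matrix (Fin m) (Fin m) ℝ), (∀ l l' : Fin K, l < l' → m * d l < d l') →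
      (∀ l, (S l).IsSymm) →
        (Matrix.det (∑ l, ((Polynomial.X : Polynomial ℝ) ^ d l) • (S l).map Polynomial.C)).roots.toFinset.card
          ≤ 2 ^ (C * (K + Nat.log 2 m ^ 2)))) :
    (∀ c q : ℕ, 0 < q → ∃ K₀ : ℕ, ∀ K m : ℕ, K₀ ≤ K → m ≤ 2 ^ ((Nat.log 2 K + c) ^ c) →
      ∀ (d : Fin K → ℕ) (S : Fin K → Matrix (Fin m) (Fin m) ℝ), (∀ l l' : Fin K, l < l' → m * d l < d l') → (∀ l, (S l).IsSymm) →
        (Matrix.det (∑ l, ((Polynomial.X : Polynomial ℝ) ^ d l) • (S l).map Polynomial.C)).roots.toFinset.card ^ q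
          ≤ 2 ^ (K * Nat.log 2 K)) := by
  obtain ⟨C, hC⟩ := h
  intro c q _hq
  obtain ⟨K₁, hK₁⟩ := StubArith4.exp_le (2 * c) (2 * q * C)
  refine ⟨max K₁ (2 ^ (2 * q * C)), fun K m hK hm d S hT hS => ?_⟩
  have hK1 : K₁ ≤ K := le_of_max_le_left hK
  have hK2 : 2 ^ (2 * q * C) ≤ K := le_of_max_le_right hK
  have hL : 2 * q * C ≤ Nat.log 2 K := Nat.le_log_of_pow_le one_lt_two hK2
  have hlogm : Nat.log 2 m ≤ (Nat.log 2 K + c) ^ c :=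
    calc Nat.log 2 m ≤ Nat.log 2 (2 ^ ((Nat.log 2 K + c) ^ c)) := Nat.log_mono_right hm
      _ = (Nat.log 2 K + c) ^ c := Nat.log_pow one_lt_two _
  have hsq : Nat.log 2 m ^ 2 ≤ (Nat.log 2 K + 2 * c) ^ (2 * c) :=
    calc Nat.log 2 m ^ 2 ≤ ((Nat.log 2 K + c) ^ c) ^ 2 := Nat.pow_le_pow_left hlogm 2
      _ = (Nat.log 2 K + c) ^ (2 * c) := by rw [← pow_mul, mul_comm]
      _ ≤ (Nat.log 2 K + 2 * c) ^ (2 * c) := Nat.pow_le_pow_left (by omega) _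
  have hZ := hC m K d S hT hS
  have h1 : 2 * q * C * (Nat.log 2 K + 2 * c) ^ (2 * c) ≤ K * Nat.log 2 K := hK₁ K hK1
  have h2 : 2 * q * C * K ≤ K * Nat.log 2 K :=
    calc 2 * q * C * K = K * (2 * q * C) := by ring
      _ ≤ K * Nat.log 2 K := Nat.mul_le_mul_left K hL
  have h3 : q * C * Nat.log 2 m ^ 2 ≤ q * C * (Nat.log 2 K + 2 * c) ^ (2 * c) :=
    Nat.mul_le_mul_left _ hsq
  have hexp : q * (C * (K + Nat.log 2 m ^ 2)) ≤ K * Nat.log 2 K := by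
    have e1 : q * (C * (K + Nat.log 2 m ^ 2)) = q * C * K + q * C * Nat.log 2 m ^ 2 := by ring
    have e2 : 2 * q * C * (Nat.log 2 K + 2 * c) ^ (2 * c) =
        2 * (q * C * (Nat.log 2 K + 2 * c) ^ (2 * c)) := by ring
    have e3 : 2 * q * C * K = 2 * (q * C * K) := by ring
    rw [e2] at h1
    rw [e3] at h2
    omega
  calc (Matrix.det (∑ l, ((Polynomial.X : Polynomial ℝ) ^ d l) • (S l).map Polynomial.C)
          ).roots.toFinset.card ^ q
      ≤ (2 ^ (C * (K + Nat.log 2 m ^ 2))) ^ q := Nat.pow_le_pow_left hZ q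
    _ = 2 ^ (q * (C * (K + Nat.log 2 m ^ 2))) := by rw [← pow_mul, mul_comm]
    _ ≤ 2 ^ (K * Nat.log 2 K) := Nat.pow_le_pow_right (by norm_num) hexp

/-- The crux as printed gives its tower restriction (restriction). -/
theorem towerMatrixDescartes_of_matrixDescartes (h : MatrixDescartes) :
    (∀ c q : ℕ, 0 < q → ∃ K₀ : ℕ, ∀ K m : ℕ, K₀ ≤ K → m ≤ 2 ^ ((Nat.log 2 K + c) ^ c) →
      ∀ (d : Fin K → ℕ) (S : Fin K → Matrix (Fin m) (Fin m) ℝ), (∀ l l' : Fin K, l < l' → m * d l < d l') → (∀ l, (S l).IsSymm) →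
        (Matrix.det (∑ l, ((Polynomial.X : Polynomial ℝ) ^ d l) • (S l).map Polynomial.C)).roots.toFinset.card ^ q
          ≤ 2 ^ (K * Nat.log 2 K)) := by
  intro c q hq
  obtain ⟨K₀, hK⟩ := h c q hq
  exact ⟨K₀, fun K m hK0 hm d S _ hS => hK K m hK0 hm d S hS⟩

/-- **The tower door decides the summit**: `TowerMatrixDescartes → PencilTransfer → TowerThetaWitness → VP ≠ VNP`
(the arithmetic of `LacunarySymmetroid.closes`; new step: the transferred support `Fin.cons 0 (2^n)^i` is an
`m`-tower because `m ≤ 2^{(log n + c)^c} < 2^n`, `window_lt` + `isTower_cons_pow`). -/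
theorem closes_tower (hMDR : (∀ c q : ℕ, 0 < q → ∃ K₀ : ℕ, ∀ K m : ℕ, K₀ ≤ K → m ≤ 2 ^ ((Nat.log 2 K + c) ^ c) →
      ∀ (d : Fin K → ℕ) (S : Fin K → Matrix (Fin m) (Fin m) ℝ), (∀ l l' : Fin K, l < l' → m * d l < d l') → (∀ l, (S l).IsSymm) →
        (Matrix.det (∑ l, ((Polynomial.X : Polynomial ℝ) ^ d l) • (S l).map Polynomial.C)).roots.toFinset.card ^ q
          ≤ 2 ^ (K * Nat.log 2 K)))
    (hT : PencilTransfer) (hW : (∃ Θ : ∀ n : ℕ, MvPolynomial (Fin n) ℝ,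
      Literature.Computability.AlgebraicComplexity.IsVNPFamily (fun n => MvPolynomial.map (algebraMap ℝ ℂ) (Θ n)) ∧
        ∃ n₀ : ℕ, ∀ n : ℕ, n₀ ≤ n → 2 ^ (n * Nat.log 2 n) ≤
          (MvPolynomial.aeval (fun i : Fin n => (Polynomial.X : Polynomial ℝ) ^ (2 ^ n) ^ (i : ℕ)) (Θ n)).roots.toFinset.card + 1)) :
    _root_.ValiantsHypothesis := by
  show Literature.Computability.AlgebraicComplexity.VP ℂ ≠ Literature.Computability.AlgebraicComplexity.VNP ℂ
  intro hEq
  obtain ⟨Θ, hVNP, n₀, hroots⟩ := hW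
  set d : (n : ℕ) → Fin n → ℕ := fun n i => (2 ^ n) ^ (i : ℕ) with hd
  have hVP : Literature.Computability.AlgebraicComplexity.IsVPFamily
      (fun n => MvPolynomial.map (algebraMap ℝ ℂ) (Θ n)) := by
    have hmem := (Literature.Computability.AlgebraicComplexity.mem_VNP_ofFintype_iff_holds _).2 hVNP
    rw [← hEq] at hmem
    exact (Literature.Computability.AlgebraicComplexity.mem_VP_ofFintype_iff_holds _).1 hmem
  obtain ⟨c, hc⟩ := hT (fun n => n) Θ hVP d
  obtain ⟨K₀, hK⟩ := hMDR c 4 (by norm_num)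
  obtain ⟨n₁, hn₁⟩ := window_lt c
  obtain ⟨n, hn₀, hnK, hn4, hn1⟩ : ∃ n, n₀ ≤ n ∧ K₀ ≤ n ∧ 4 ≤ n ∧ n₁ ≤ n :=
    ⟨n₀ + K₀ + 4 + n₁, by omega, by omega, by omega, by omega⟩
  obtain ⟨m, hm, S, hS, hroot⟩ := hc n
  set Z := (MvPolynomial.aeval (fun i => (Polynomial.X : Polynomial ℝ) ^ d n i) (Θ n)).roots.toFinset.card
    with hZ
  have hm' : m ≤ 2 ^ ((Nat.log 2 (n + 1) + c) ^ c) :=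
    hm.trans (Nat.pow_le_pow_right (by norm_num)
      (Nat.pow_le_pow_left (Nat.add_le_add_right (Nat.log_mono_right (Nat.le_succ n)) c) c))
  -- NEW STEP: the transferred support is an `m`-tower
  have hmG : m < 2 ^ n :=
    lt_of_le_of_lt hm (Nat.pow_lt_pow_right (by norm_num) (hn₁ n hn1))
  have hTow : ∀ l l' : Fin (n + 1), l < l' →
      m * (Fin.cons (α := fun _ => ℕ) (0 : ℕ) (d n) l) < Fin.cons (α := fun _ => ℕ) (0 : ℕ) (d n) l' :=
    isTower_cons_pow hmG
  have h1 := hK (n + 1) m (by omega) hm' (Fin.cons (α := fun _ => ℕ) (0 : ℕ) (d n)) S hTow hS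
  rw [hroot] at h1
  have h2 : 2 ^ (n * Nat.log 2 n) ≤ Z + 1 := hroots n hn₀
  set L := Nat.log 2 n with hL
  have hL2 : 2 ≤ L := by
    rw [hL]
    calc 2 = Nat.log 2 4 := by decide
      _ ≤ Nat.log 2 n := Nat.log_mono_right hn4
  have hLn : L ≤ n := by rw [hL]; exact Nat.log_le_self 2 n
  have hL' : Nat.log 2 (n + 1) ≤ L + 1 := by
    rw [hL]
    calc Nat.log 2 (n + 1) ≤ Nat.log 2 (n * 2) := Nat.log_mono_right (by omega)
      _ = Nat.log 2 n + 1 := Nat.log_mul_base (by norm_num) (by omega)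
  have h3 : Z ^ 4 ≤ 2 ^ ((n + 1) * (L + 1)) :=
    h1.trans (Nat.pow_le_pow_right (by norm_num) (Nat.mul_le_mul_left _ hL'))
  have hnL : 1 ≤ n * L := by nlinarith
  have h4 : 2 ^ (n * L - 1) ≤ Z := by
    have e : 2 ^ (n * L) = 2 * 2 ^ (n * L - 1) := by
      rw [← Nat.pow_succ']
      congr 1
      omega
    have h2' := h2
    rw [e] at h2'
    have : 1 ≤ 2 ^ (n * L - 1) := Nat.one_le_two_pow
    omega
  have h5 : 2 ^ (4 * (n * L - 1)) ≤ Z ^ 4 := by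
    rw [pow_mul']
    exact Nat.pow_le_pow_left h4 4
  have h6 : 4 * (n * L - 1) ≤ (n + 1) * (L + 1) :=
    (Nat.pow_le_pow_iff_right (by norm_num)).1 (h5.trans h3)
  have h7 : 6 * n ≤ 3 * (n * L) := by nlinarith
  have h6' : 4 * (n * L - 1) ≤ n * L + n + L + 1 := by
    have e : (n + 1) * (L + 1) = n * L + n + L + 1 := by ring
    rw [e] at h6
    exact h6
  generalize hP : n * L = P at h6' h7 hnL
  omega

/-- **Corollary (the re-glue)**: `TowerRealRootLaw → PencilTransfer → TowerThetaWitness → VP ≠ VNP`. -/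
theorem valiant_of_towerRealRootLaw (hB : (∃ C : ℕ, ∀ (m K : ℕ) (d : Fin K → ℕ) (S : Fin K → Matrix (Fin m) (Fin m) ℝ), (∀ l l' : Fin K, l < l' → m * d l < d l') →
      (∀ l, (S l).IsSymm) →
        (Matrix.det (∑ l, ((Polynomial.X : Polynomial ℝ) ^ d l) • (S l).map Polynomial.C)).roots.toFinset.card
          ≤ 2 ^ (C * (K + Nat.log 2 m ^ 2))))
    (hT : PencilTransfer) (hW : (∃ Θ : ∀ n : ℕ, MvPolynomial (Fin n) ℝ,
      Literature.Computability.AlgebraicComplexity.IsVNPFamily (fun n => MvPolynomial.map (algebraMap ℝ ℂ) (Θ n)) ∧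
        ∃ n₀ : ℕ, ∀ n : ℕ, n₀ ≤ n → 2 ^ (n * Nat.log 2 n) ≤
          (MvPolynomial.aeval (fun i : Fin n => (Polynomial.X : Polynomial ℝ) ^ (2 ^ n) ^ (i : ℕ)) (Θ n)).roots.toFinset.card + 1)) :
    _root_.ValiantsHypothesis :=
  closes_tower (towerMatrixDescartes_of_towerRealRootLaw hB) hT hW

/-- **LINE (B)'s head feeds the door**: `TowerB → TowerRealRootLaw` (reflection `X ↦ −X` keeps the support, hence
the tower property, and the letters symmetric: `card ≤ ζ₊(F) + ζ₊(F(−X)) + 1 ≤ 2^{(C+2)(K + log² m)}`, tree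
`stub_negRoots`). -/
theorem towerRealRootLaw_of_towerB (h : (∃ C : ℕ, ∀ (m K : ℕ) (d : Fin K → ℕ), (∀ l l' : Fin K, l < l' → m * d l < d l') →
      PosRootLawOn m K (2 ^ (C * (K + Nat.log 2 m ^ 2))) d)) :
    (∃ C : ℕ, ∀ (m K : ℕ) (d : Fin K → ℕ) (S : Fin K → Matrix (Fin m) (Fin m) ℝ), (∀ l l' : Fin K, l < l' → m * d l < d l') →
      (∀ l, (S l).IsSymm) →
        (Matrix.det (∑ l, ((Polynomial.X : Polynomial ℝ) ^ d l) • (S l).map Polynomial.C)).roots.toFinset.card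
          ≤ 2 ^ (C * (K + Nat.log 2 m ^ 2))) := by
  obtain ⟨C, hC⟩ := h
  refine ⟨C + 2, fun m K d S hd hS => ?_⟩
  rcases Nat.eq_zero_or_pos K with hK | hK
  · subst hK
    have h0 : (∑ l : Fin 0, (Polynomial.X : Polynomial ℝ) ^ d l • (S l).map Polynomial.C) = 0 := by simp
    rw [h0]
    rcases Nat.eq_zero_or_pos m with hm | hm
    · subst hm; simp [Matrix.det_isEmpty]
    · haveI : Nonempty (Fin m) := ⟨⟨0, hm⟩⟩
      simp [Matrix.det_zero]
  · have h1 := hC m K d hd S hS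
    have h2 := hC m K d hd (fun l => ((-1 : ℝ) ^ d l) • S l) (fun l => (hS l).smul _)
    have h3 := stub_negRoots K m d S
    set A := C * (K + Nat.log 2 m ^ 2) with hAdef
    have h4 : 2 ^ A + 2 ^ A + 1 ≤ 2 ^ ((C + 2) * (K + Nat.log 2 m ^ 2)) := by
      have h5 : (C + 2) * (K + Nat.log 2 m ^ 2) = A + 2 * (K + Nat.log 2 m ^ 2) := by rw [hAdef]; ring
      have h6 : 2 ≤ 2 * (K + Nat.log 2 m ^ 2) := by omega
      have h7 : 2 ^ 2 ≤ 2 ^ (2 * (K + Nat.log 2 m ^ 2)) := Nat.pow_le_pow_right two_pos h6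
      have h8 : 1 ≤ 2 ^ A := Nat.one_le_two_pow
      calc 2 ^ A + 2 ^ A + 1 ≤ 2 ^ A * 2 ^ 2 := by omega
        _ ≤ 2 ^ A * 2 ^ (2 * (K + Nat.log 2 m ^ 2)) := Nat.mul_le_mul_left _ h7
        _ = 2 ^ ((C + 2) * (K + Nat.log 2 m ^ 2)) := by rw [h5, pow_add]
    exact h3.trans ((Nat.add_le_add (Nat.add_le_add h1 h2) le_rfl).trans h4)

/-- **LINE (B)'s HEAD IS SUMMIT-DECIDING**: `TowerB → PencilTransfer → TowerThetaWitness → VP ≠ VNP`.  With the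
tree's PROVED joints this is one application away from the registered stubs: `valiant_of_towerB (towerB_of_graftLaw hGL)`
(S5, the graft law (GL)) and `valiant_of_towerB towerB_of_sizeDoublingPoly` (S4f + closed S4h) — both checked in this
seat's folder version of the file that imports `tower_graft` directly (`Sketch.lean`, rc 0; attached as item evidence). -/
theorem valiant_of_towerB (hB : (∃ C : ℕ, ∀ (m K : ℕ) (d : Fin K → ℕ), (∀ l l' : Fin K, l < l' → m * d l < d l') →
      PosRootLawOn m K (2 ^ (C * (K + Nat.log 2 m ^ 2))) d))
    (hT : PencilTransfer) (hW : (∃ Θ : ∀ n : ℕ, MvPolynomial (Fin n) ℝ,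
      Literature.Computability.AlgebraicComplexity.IsVNPFamily (fun n => MvPolynomial.map (algebraMap ℝ ℂ) (Θ n)) ∧
        ∃ n₀ : ℕ, ∀ n : ℕ, n₀ ≤ n → 2 ^ (n * Nat.log 2 n) ≤
          (MvPolynomial.aeval (fun i : Fin n => (Polynomial.X : Polynomial ℝ) ^ (2 ^ n) ^ (i : ℕ)) (Θ n)).roots.toFinset.card + 1)) : _root_.ValiantsHypothesis :=
  valiant_of_towerRealRootLaw (towerRealRootLaw_of_towerB hB) hT hW


/-! ## The joints — the other two legs DISCHARGED by the tree -/

/-- **`TowerB → VP ≠ VNP`** (`PencilTransfer` from the tree's `pencilTransfer_proof`, the tower witness from `towerThetaWitness_holds`).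
VP ≠ VNP is NOT proved: `TowerB` is open. [folklore] -/
theorem valiant_of_towerB_alone
    (hB : (∃ C : ℕ, ∀ (m K : ℕ) (d : Fin K → ℕ), (∀ l l' : Fin K, l < l' → m * d l < d l') →
      PosRootLawOn m K (2 ^ (C * (K + Nat.log 2 m ^ 2))) d)) :
    _root_.ValiantsHypothesis :=
  valiant_of_towerB hB
    Summit.ValiantsHypothesis.ValiantsHypothesis.Theorems.LacunarySymmetroid.pencilTransfer_proof
    towerThetaWitness_holds

/-- **`TowerRealRootLaw → VP ≠ VNP`** (all-real-roots currency of the tower door). [folklore] -/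
theorem valiant_of_towerRealRootLaw_alone
    (h : (∃ C : ℕ, ∀ (m K : ℕ) (d : Fin K → ℕ) (S : Fin K → Matrix (Fin m) (Fin m) ℝ), (∀ l l' : Fin K, l < l' → m * d l < d l') →
      (∀ l, (S l).IsSymm) →
        (Matrix.det (∑ l, ((Polynomial.X : Polynomial ℝ) ^ d l) • (S l).map Polynomial.C)).roots.toFinset.card
          ≤ 2 ^ (C * (K + Nat.log 2 m ^ 2)))) :
    _root_.ValiantsHypothesis :=
  closes_tower (towerMatrixDescartes_of_towerRealRootLaw h)
    Summit.ValiantsHypothesis.ValiantsHypothesis.Theorems.LacunarySymmetroid.pencilTransfer_proof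
    towerThetaWitness_holds

end Summit.ValiantsHypothesis.ValiantsHypothesis.Theorems.LacunarySymmetroid.TowerDoor
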